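import Summits.AtomisticToContinuum.HydrodynamicLimit.Theorems.OneFlightGossipEngineEnergyCurrentTailsQuarticLedger
import Summits.AtomisticToContinuum.HydrodynamicLimit.Theorems.OneFlightGossipEngineEnergyCurrentTailsGainCeilingGlue
import Literature.Analysis.FluidPDE.HardSphereCollisionRecord
import HarnessLib

/-!
# The window quartic floor from the quartic ledger (stub WF of the line `quartic-schur-ledger`,
# crux `EnergyCurrentTails`, stmt-AtomisticToContinuum-9235)

Stub worker file for the registered stub `stub_windowQuarticFloor` of the line lead's skeleton
`Cruxes/EnergyCurrentTails/Lines/quartic_schur_ledger.lean` (primary crux decl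
`Summit.AtomisticToContinuum.HydrodynamicLimit.Theses.WarmColdDichotomy.EnergyCurrentTails`).

**Statement.**  Write `λ_N = localGibbsLaw σ a₀ u₀ θ₀ N Φ`, `vᵢ(r) = (Φ.flow r z i).2`,
`y(r) = ∫ ofReal((N+1)⁻¹ ∑ᵢ ‖vᵢ(r)‖⁴) dλ_N`, `Loss(s,s'] = ∫ ofReal((N+1)⁻¹ collisionSum_{(s,s']} (Δ₄)₋/2) dλ_N`
(`Δ₄ = ‖v₁⁺‖⁴ + ‖v₂⁺‖⁴ − ‖v₁⁻‖⁴ − ‖v₂⁻‖⁴` of a collision record) and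
`M₅^{>K₀}(r) = ∫ ofReal((N+1)⁻¹ ∑ᵢ 𝟙{K₀ < ‖vᵢ(r)‖} ‖vᵢ(r)‖⁵) dλ_N`.  For continuous profiles
`a₀, θ₀ > 0`, `u₀`, reduced density `0 < σ < 1/2`, every `N`, flow `Φ`, threshold `K₀ ≥ 0` and
`0 ≤ s ≤ s'`:
`ofReal((s'−s)K₀) · y(s) ≤ ∫_{(s,s']} M₅^{>K₀}(r) dr + ofReal((s'−s)K₀⁵) + ofReal((s'−s)K₀) · Loss(s,s']`.

**Proof.**  For `r ∈ (s, s']` the landed ledger `stub_quarticLedger` at `(s, r)` reads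
`y(r) + Loss(s,r] = y(s) + Gain(s,r]`, so `y(s) ≤ y(r) + Loss(s,r] ≤ y(r) + Loss(s,s']`, the loss
being monotone in the window (its summand `(Δ₄)₋/2 ≥ 0`; `collisionPairSum_union` on the conull good
set).  Pointwise `K₀‖v‖⁴ ≤ 𝟙{K₀<‖v‖}‖v‖⁵ + K₀⁵`, so, `λ_N` being a probability measure,
`ofReal K₀ · y(r) ≤ M₅^{>K₀}(r) + ofReal(K₀⁵)`; hence
`ofReal K₀ · y(s) ≤ M₅^{>K₀}(r) + ofReal(K₀⁵) + ofReal K₀ · Loss(s,s']` for every `r ∈ (s,s']`, and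
integrating `dr` over `(s, s']` (`volume (Ioc s s') = ofReal (s' − s)`, the constant part of the
integrand is measurable) gives the claim.  Everything is in `ℝ≥0∞`; no finiteness is needed.

References: Bobylev 1997 / Mischler–Wennberg 1999 (Povzner-type quartic bookkeeping; truncation
of moments at a velocity threshold), Cercignani–Illner–Pulvirenti 1994 §4.2.
-/

noncomputable section

open MeasureTheory Set Filter
open scoped ENNReal InnerProductSpace

namespace Summit.AtomisticToContinuum.HydrodynamicLimit.Theorems.QuarticSchurLedger

open Literature.MathematicalPhysics.KineticTheory Literature.Analysis.FluidPDE

/-! ### Elementary real inequalities -/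

/-- **Truncated quartic bound**: for `K₀ ≥ 0` and `aᵢ ≥ 0`,
`K₀ · (N+1)⁻¹ ∑ᵢ aᵢ⁴ ≤ (N+1)⁻¹ ∑ᵢ 𝟙{K₀ < aᵢ} aᵢ⁵ + K₀⁵` (termwise: `K₀ aᵢ⁴ ≤ aᵢ⁵` if `K₀ < aᵢ`,
`K₀ aᵢ⁴ ≤ K₀⁵` otherwise; the constant averages to `K₀⁵`). [folklore] -/
theorem windowFloor_K_mul_quarticAvg_le {N : ℕ} {K₀ : ℝ} (hK₀ : 0 ≤ K₀) (a : Fin (N + 1) → ℝ)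
    (ha : ∀ i, 0 ≤ a i) :
    K₀ * (((N : ℝ) + 1)⁻¹ * ∑ i, a i ^ 4) ≤
      ((N : ℝ) + 1)⁻¹ * ∑ i, (if K₀ < a i then a i ^ 5 else 0) + K₀ ^ 5 := by
  have hpt : ∀ i, K₀ * a i ^ 4 ≤ (if K₀ < a i then a i ^ 5 else 0) + K₀ ^ 5 := by
    intro i
    split_ifs with h
    · have h1 : K₀ * a i ^ 4 ≤ a i * a i ^ 4 := mul_le_mul_of_nonneg_right h.le (by positivity)
      have h2 : a i * a i ^ 4 = a i ^ 5 := by ring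
      have h3 : 0 ≤ K₀ ^ 5 := by positivity
      linarith
    · have h1 : K₀ * a i ^ 4 ≤ K₀ * K₀ ^ 4 :=
        mul_le_mul_of_nonneg_left (pow_le_pow_left₀ (ha i) (not_lt.1 h) 4) hK₀
      have h2 : K₀ * K₀ ^ 4 = K₀ ^ 5 := by ring
      linarith
  have hsum : K₀ * ∑ i, a i ^ 4 ≤
      (∑ i, (if K₀ < a i then a i ^ 5 else 0)) + ((N : ℝ) + 1) * K₀ ^ 5 := by
    rw [Finset.mul_sum]
    refine (Finset.sum_le_sum fun i _ => hpt i).trans_eq ?_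
    rw [Finset.sum_add_distrib, Finset.sum_const, Finset.card_univ, Fintype.card_fin, nsmul_eq_mul,
      Nat.cast_add, Nat.cast_one]
  have hN : (0 : ℝ) < (N : ℝ) + 1 := by positivity
  calc K₀ * (((N : ℝ) + 1)⁻¹ * ∑ i, a i ^ 4)
      = ((N : ℝ) + 1)⁻¹ * (K₀ * ∑ i, a i ^ 4) := by ring
    _ ≤ ((N : ℝ) + 1)⁻¹ * ((∑ i, (if K₀ < a i then a i ^ 5 else 0)) + ((N : ℝ) + 1) * K₀ ^ 5) :=
        mul_le_mul_of_nonneg_left hsum (inv_nonneg.2 hN.le)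
    _ = _ := by rw [mul_add, ← mul_assoc, inv_mul_cancel₀ hN.ne', one_mul]

/-! ### Pathwise: the loss is monotone in the window -/

section Pathwise

variable {d X : Type*} [Fintype d] [MeasureSpace X] [TopologicalSpace X] {G : Geometry d X}
  {ε : ℝ} {n : ℕ}

/-- **Window monotonicity of the loss collision sum** on a good orbit: for `s ≤ r ≤ s'` the
collision sum of the non-negative summand `(Δ₄)₋/2` over `(s, r]` is at most the one over `(s, s']`
(`Ioc s s' = Ioc s r ∪ Ioc r s'`, `collisionPairSum_union`, finitely many collision times in each
bounded window, `collisionPairSum_nonneg`). [folklore] -/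
theorem windowFloor_lossSum_mono (Φ : HardSphereFlow G ε n) {z : Config n d X} (hz : z ∈ Φ.good)
    {s r s' : ℝ} (hsr : s ≤ r) (hrs' : r ≤ s') :
    Φ.collisionSum (Ioc s r)
        (fun col => max (‖col.preVel.1‖ ^ 4 + ‖col.preVel.2‖ ^ 4
          - ‖col.postVel.1‖ ^ 4 - ‖col.postVel.2‖ ^ 4) 0 / 2) z ≤
      Φ.collisionSum (Ioc s s')
        (fun col => max (‖col.preVel.1‖ ^ 4 + ‖col.preVel.2‖ ^ 4
          - ‖col.postVel.1‖ ^ 4 - ‖col.postVel.2‖ ^ 4) 0 / 2) z := by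
  rw [HardSphereFlow.collisionSum_eq, HardSphereFlow.collisionSum_eq,
    collisionSum_eq_collisionPairSum, collisionSum_eq_collisionPairSum,
    ← Ioc_union_Ioc_eq_Ioc hsr hrs',
    collisionPairSum_union (Φ.finite_collisionTimes_inter hz Ioc_subset_Icc_self)
      (Φ.finite_collisionTimes_inter hz Ioc_subset_Icc_self) (Ioc_disjoint_Ioc_of_le le_rfl)]
  exact le_add_of_nonneg_right (collisionPairSum_nonneg fun _ _ _ => by positivity)

end Pathwise

/-! ### Integrated bounds under the local Gibbs law -/

section Torus

variable {N : ℕ} {ε : ℝ}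

/-- **Truncated quartic moment bound, integrated**: under a probability law,
`ofReal K₀ · ∫ ofReal((N+1)⁻¹∑ᵢ‖vᵢ(r)‖⁴) ≤ ∫ ofReal((N+1)⁻¹∑ᵢ 𝟙{K₀<‖vᵢ(r)‖}‖vᵢ(r)‖⁵) + ofReal(K₀⁵)`
(`windowFloor_K_mul_quarticAvg_le` pointwise, `lintegral_const_mul_le`, mass one). [folklore] -/
theorem windowFloor_K_mul_lintegral_quartic_le
    (Φ : HardSphereFlow (Torus.geometry (Fin 3)) ε (N + 1))
    (μ : Measure (Config (N + 1) (Fin 3) T3)) [IsProbabilityMeasure μ] (r : ℝ) {K₀ : ℝ}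
    (hK₀ : 0 ≤ K₀) :
    ENNReal.ofReal K₀ *
        (∫⁻ z, ENNReal.ofReal (((N : ℝ) + 1)⁻¹ * ∑ i : Fin (N + 1), ‖(Φ.flow r z i).2‖ ^ 4) ∂μ) ≤
      (∫⁻ z, ENNReal.ofReal (((N : ℝ) + 1)⁻¹ *
          ∑ i : Fin (N + 1), (if K₀ < ‖(Φ.flow r z i).2‖ then ‖(Φ.flow r z i).2‖ ^ 5 else 0)) ∂μ) +
        ENNReal.ofReal (K₀ ^ 5) := by
  have hc : (0 : ℝ) ≤ ((N : ℝ) + 1)⁻¹ := by positivity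
  have hC : Measurable fun _ : Config (N + 1) (Fin 3) T3 => ENNReal.ofReal (K₀ ^ 5) :=
    measurable_const
  calc ENNReal.ofReal K₀ *
        (∫⁻ z, ENNReal.ofReal (((N : ℝ) + 1)⁻¹ * ∑ i : Fin (N + 1), ‖(Φ.flow r z i).2‖ ^ 4) ∂μ)
      ≤ ∫⁻ z, ENNReal.ofReal K₀ *
          ENNReal.ofReal (((N : ℝ) + 1)⁻¹ * ∑ i : Fin (N + 1), ‖(Φ.flow r z i).2‖ ^ 4) ∂μ :=
        lintegral_const_mul_le _ _
    _ ≤ ∫⁻ z, (ENNReal.ofReal (((N : ℝ) + 1)⁻¹ *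
          ∑ i : Fin (N + 1), (if K₀ < ‖(Φ.flow r z i).2‖ then ‖(Φ.flow r z i).2‖ ^ 5 else 0)) +
          ENNReal.ofReal (K₀ ^ 5)) ∂μ := by
        refine lintegral_mono fun z => ?_
        have h5 : 0 ≤ ((N : ℝ) + 1)⁻¹ *
            ∑ i : Fin (N + 1), (if K₀ < ‖(Φ.flow r z i).2‖ then ‖(Φ.flow r z i).2‖ ^ 5 else 0) :=
          mul_nonneg hc (Finset.sum_nonneg fun i _ => by split_ifs <;> positivity)
        rw [← ENNReal.ofReal_mul hK₀, ← ENNReal.ofReal_add h5 (by positivity)]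
        exact ENNReal.ofReal_le_ofReal
          (windowFloor_K_mul_quarticAvg_le hK₀ (fun i => ‖(Φ.flow r z i).2‖) fun i => norm_nonneg _)
    _ = _ := by rw [lintegral_add_right _ hC, lintegral_const, measure_univ, mul_one]

/-- **Window monotonicity of the expected loss**: for `s ≤ r ≤ s'`, `Loss(s,r] ≤ Loss(s,s']` under
the local Gibbs law (pathwise `windowFloor_lossSum_mono` on the conull good set,
`ae_mem_good_localGibbsLaw`, `lintegral_mono_ae`). [folklore] -/
theorem windowFloor_lintegral_loss_mono {σ : ℝ} (a₀ θ₀ : T3 → ℝ) (u₀ : T3 → V3)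
    (Φ : HardSphereFlow (Torus.geometry (Fin 3)) (hsDiameter σ N) (N + 1)) {s r s' : ℝ}
    (hsr : s ≤ r) (hrs' : r ≤ s') :
    (∫⁻ z, ENNReal.ofReal (((N : ℝ) + 1)⁻¹ *
        Φ.collisionSum (Set.Ioc s r)
          (fun col => max (‖col.preVel.1‖ ^ 4 + ‖col.preVel.2‖ ^ 4
            - ‖col.postVel.1‖ ^ 4 - ‖col.postVel.2‖ ^ 4) 0 / 2) z)
      ∂(localGibbsLaw σ a₀ u₀ θ₀ N Φ)) ≤
      (∫⁻ z, ENNReal.ofReal (((N : ℝ) + 1)⁻¹ *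
        Φ.collisionSum (Set.Ioc s s')
          (fun col => max (‖col.preVel.1‖ ^ 4 + ‖col.preVel.2‖ ^ 4
            - ‖col.postVel.1‖ ^ 4 - ‖col.postVel.2‖ ^ 4) 0 / 2) z)
      ∂(localGibbsLaw σ a₀ u₀ θ₀ N Φ)) := by
  have hc : (0 : ℝ) ≤ ((N : ℝ) + 1)⁻¹ := by positivity
  refine lintegral_mono_ae ?_
  filter_upwards [ae_mem_good_localGibbsLaw σ a₀ u₀ θ₀ N Φ] with z hz
  exact ENNReal.ofReal_le_ofReal
    (mul_le_mul_of_nonneg_left (windowFloor_lossSum_mono Φ hz hsr hrs') hc)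

/-- **One-sided ledger with a monotone loss**: for `0 < σ < 1/2`, `0 ≤ s ≤ r ≤ s'`,
`y(s) ≤ y(r) + Loss(s,s']` — the landed ledger `stub_quarticLedger` at `(s, r)` gives
`y(s) ≤ y(s) + Gain(s,r] = y(r) + Loss(s,r]`, and `Loss(s,r] ≤ Loss(s,s']`
(`windowFloor_lintegral_loss_mono`). [folklore] -/
theorem windowFloor_quartic_le_add_loss (a₀ θ₀ : T3 → ℝ) (u₀ : T3 → V3) {σ : ℝ} (hσ : 0 < σ)
    (hσ2 : σ < 1 / 2) (N : ℕ)
    (Φ : HardSphereFlow (Torus.geometry (Fin 3)) (hsDiameter σ N) (N + 1)) {s r s' : ℝ}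
    (hs : 0 ≤ s) (hsr : s ≤ r) (hrs' : r ≤ s') :
    (∫⁻ z, ENNReal.ofReal (((N : ℝ) + 1)⁻¹ * ∑ i : Fin (N + 1), ‖(Φ.flow s z i).2‖ ^ 4)
        ∂(localGibbsLaw σ a₀ u₀ θ₀ N Φ)) ≤
      (∫⁻ z, ENNReal.ofReal (((N : ℝ) + 1)⁻¹ * ∑ i : Fin (N + 1), ‖(Φ.flow r z i).2‖ ^ 4)
          ∂(localGibbsLaw σ a₀ u₀ θ₀ N Φ)) +
        (∫⁻ z, ENNReal.ofReal (((N : ℝ) + 1)⁻¹ *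
            Φ.collisionSum (Set.Ioc s s')
              (fun col => max (‖col.preVel.1‖ ^ 4 + ‖col.preVel.2‖ ^ 4
                - ‖col.postVel.1‖ ^ 4 - ‖col.postVel.2‖ ^ 4) 0 / 2) z)
          ∂(localGibbsLaw σ a₀ u₀ θ₀ N Φ)) := by
  have hled := stub_quarticLedger a₀ θ₀ u₀ σ hσ hσ2 N Φ s r hs hsr
  exact (le_self_add.trans_eq hled.symm).trans
    (add_le_add_right (windowFloor_lintegral_loss_mono a₀ θ₀ u₀ Φ hsr hrs') _)

end Torus

/-! ### Assembly in `ℝ≥0∞` -/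

/-- One `r`-slice of the window floor: from `Y ≤ Y_r + L` and `K · Y_r ≤ M + G₅`,
`K · Y ≤ M + (G₅ + K · L)` in `ℝ≥0∞`. [folklore] -/
theorem windowFloor_slice {K Y Yr L M G₅ : ℝ≥0∞} (h1 : Y ≤ Yr + L) (h2 : K * Yr ≤ M + G₅) :
    K * Y ≤ M + (G₅ + K * L) := by
  calc K * Y ≤ K * (Yr + L) := mul_le_mul_right h1 _
    _ = K * Yr + K * L := mul_add _ _ _
    _ ≤ (M + G₅) + K * L := add_le_add_left h2 _
    _ = M + (G₅ + K * L) := add_assoc _ _ _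

/-- **Integration of the slices over the window**: if
`ofReal K₀ · Y ≤ M₅(r) + (ofReal(K₀⁵) + ofReal K₀ · L)` for every `r ∈ (s, s']` (`s ≤ s'`), then
`ofReal((s'−s)K₀) · Y ≤ ∫_{(s,s']} M₅ + ofReal((s'−s)K₀⁵) + ofReal((s'−s)K₀) · L`
(`setLIntegral_const`, `Real.volume_Ioc`, `setLIntegral_mono'`, `lintegral_add_right` with the
measurable constant part; `M₅` need not be measurable). [folklore] -/
theorem windowFloor_assembly {Y L : ℝ≥0∞} {M₅ : ℝ → ℝ≥0∞} {K₀ s s' : ℝ}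
    (hss' : s ≤ s')
    (hpt : ∀ r ∈ Ioc s s',
      ENNReal.ofReal K₀ * Y ≤ M₅ r + (ENNReal.ofReal (K₀ ^ 5) + ENNReal.ofReal K₀ * L)) :
    ENNReal.ofReal ((s' - s) * K₀) * Y ≤
      (∫⁻ r in Ioc s s', M₅ r) + ENNReal.ofReal ((s' - s) * K₀ ^ 5) +
        ENNReal.ofReal ((s' - s) * K₀) * L := by
  have hvol : volume (Ioc s s') = ENNReal.ofReal (s' - s) := Real.volume_Ioc
  have hd : 0 ≤ s' - s := sub_nonneg.2 hss'
  have hC : Measurable fun _ : ℝ => ENNReal.ofReal (K₀ ^ 5) + ENNReal.ofReal K₀ * L :=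
    measurable_const
  calc ENNReal.ofReal ((s' - s) * K₀) * Y
      = ∫⁻ _ in Ioc s s', ENNReal.ofReal K₀ * Y := by
        rw [setLIntegral_const, hvol, ENNReal.ofReal_mul hd]
        ring
    _ ≤ ∫⁻ r in Ioc s s', (M₅ r + (ENNReal.ofReal (K₀ ^ 5) + ENNReal.ofReal K₀ * L)) :=
        setLIntegral_mono' measurableSet_Ioc hpt
    _ = (∫⁻ r in Ioc s s', M₅ r) +
          (ENNReal.ofReal (K₀ ^ 5) + ENNReal.ofReal K₀ * L) * volume (Ioc s s') := by
        rw [lintegral_add_right _ hC, setLIntegral_const]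
    _ = _ := by
        rw [hvol, ENNReal.ofReal_mul (q := K₀ ^ 5) hd, ENNReal.ofReal_mul (q := K₀) hd]
        ring

/-- **Stub WF — THE WINDOW QUARTIC FLOOR FROM THE LEDGER** (line `quartic-schur-ledger`, crux
stmt-AtomisticToContinuum-9235, `EnergyCurrentTails`).  For `0 < σ < 1/2` (so that `λ_N` is a
probability measure and the landed ledger L applies), every `N`, flow `Φ`, threshold `K₀ ≥ 0` and
`0 ≤ s ≤ s′`:
`(s′−s)K₀ · y(s) ≤ ∫_s^{s′} M₅^{>K₀}(r) dr + (s′−s)K₀⁵ + (s′−s)K₀ · Loss(s,s′]`.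
Proof: for `r ∈ (s,s′]` the ledger L (`stub_quarticLedger`) gives
`y(s) ≤ y(r) + Loss(s,r] ≤ y(r) + Loss(s,s′]` (`Gain ≥ 0`; the loss is monotone in the window since
its summand is non-negative, `windowFloor_lossSum_mono` on the good set); pointwise
`K₀‖v‖⁴ ≤ 𝟙{‖v‖>K₀}‖v‖⁵ + K₀⁵`, so `K₀ y(s) ≤ M₅^{>K₀}(r) + K₀⁵ + K₀ Loss(s,s′]` (mass one,
`windowFloor_K_mul_lintegral_quartic_le`); integrate `dr` over `(s,s′]` (`windowFloor_assembly`).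
[folklore] -/
theorem stub_windowQuarticFloor :
    ∀ (a₀ θ₀ : T3 → ℝ) (u₀ : T3 → V3), Continuous a₀ → Continuous θ₀ → Continuous u₀ →
        (∀ x, 0 < a₀ x) → (∀ x, 0 < θ₀ x) →
        ∀ σ : ℝ, 0 < σ → σ < 1 / 2 →
          ∀ (N : ℕ) (Φ : HardSphereFlow (Torus.geometry (Fin 3)) (hsDiameter σ N) (N + 1)) (K₀ : ℝ),
            0 ≤ K₀ → ∀ s s' : ℝ, 0 ≤ s → s ≤ s' →
              ENNReal.ofReal ((s' - s) * K₀) *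
                  (∫⁻ z, ENNReal.ofReal (((N : ℝ) + 1)⁻¹ *
                      ∑ i : Fin (N + 1), ‖(Φ.flow s z i).2‖ ^ 4)
                    ∂(localGibbsLaw σ a₀ u₀ θ₀ N Φ))
                ≤ (∫⁻ r in Set.Ioc s s',
                    (∫⁻ z, ENNReal.ofReal (((N : ℝ) + 1)⁻¹ *
                        ∑ i : Fin (N + 1), (if K₀ < ‖(Φ.flow r z i).2‖ then
                          ‖(Φ.flow r z i).2‖ ^ 5 else 0))
                      ∂(localGibbsLaw σ a₀ u₀ θ₀ N Φ))) +
                  ENNReal.ofReal ((s' - s) * K₀ ^ 5) +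
                  ENNReal.ofReal ((s' - s) * K₀) *
                    (∫⁻ z, ENNReal.ofReal (((N : ℝ) + 1)⁻¹ *
                        Φ.collisionSum (Set.Ioc s s')
                          (fun col => max (‖col.preVel.1‖ ^ 4 + ‖col.preVel.2‖ ^ 4
                            - ‖col.postVel.1‖ ^ 4 - ‖col.postVel.2‖ ^ 4) 0 / 2) z)
                      ∂(localGibbsLaw σ a₀ u₀ θ₀ N Φ)) := by
  intro a₀ θ₀ u₀ ha hθ hu ha0 hθ0 σ hσ hσ2 N Φ K₀ hK₀ s s' hs hss'
  haveI := isProbabilityMeasure_localGibbsLaw ha hθ hu ha0 hθ0 hσ2.le N Φ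
  refine windowFloor_assembly hss' fun r hr => ?_
  exact windowFloor_slice
    (windowFloor_quartic_le_add_loss a₀ θ₀ u₀ hσ hσ2 N Φ hs hr.1.le hr.2)
    (windowFloor_K_mul_lintegral_quartic_le Φ (localGibbsLaw σ a₀ u₀ θ₀ N Φ) r hK₀)

end Summit.AtomisticToContinuum.HydrodynamicLimit.Theorems.QuarticSchurLedger

end
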